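import Mathlib
import Summits.Ventures.HodgeRepro2.T5HeckeDoubleCoset

/-!
# The double cosets are a basis of `H(G, K)`

Blind cell `pub-hodge-repro2`, seat p8 (gen 8), Tier-5 kernel support.  `T5HeckePermutationModule`
(T5-52) identifies the Hecke algebra `H(G, K) = End_G(k[G ⧸ K])` with the `K`-fixed vectors of the
permutation module, and `T5HeckeDoubleCoset` (T5-53) attaches to a double coset `KgK` with
`KgK/K` finite its element `T_g = 1_{KgK}`.  This file proves that these elements form a BASIS:

* `FiniteDoubleCoset K` — the `K`-orbits `ω` on `G ⧸ K` (Mathlib's `MulAction.orbitRel.Quotient`)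
  whose orbit `ω.orbit = KgK/K` is finite, i.e. the double cosets `KgK` that are finite unions of
  left cosets;
* `doubleCosetVector k K ω := orbitVector k K ω.orbit` — the indicator `1_{KgK/K} ∈ k[G ⧸ K]`;
  `coeff_doubleCosetVector`, `doubleCosetVector_mem_invariants`;
* `mem_invariants_ofMulAction_iff` — `f ∈ k[G ⧸ K]^K` iff its coefficient function is constant on
  `K`-orbits; `coeff_eq_of_mem_orbit`;
* `linearIndependent_doubleCosetVector` and `span_doubleCosetVector_eq` — the indicators of the
  finite double cosets are linearly independent and span `k[G ⧸ K]^K`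
  (a `K`-invariant finitely supported function is supported on finitely many FINITE orbits);
* `doubleCosetBasis : Module.Basis (FiniteDoubleCoset K) k (invariants (ofMulAction k G (G ⧸ K)) K)`
  and `heckeAlgebraBasis : Module.Basis (FiniteDoubleCoset K) k (heckeAlgebra k K)` — THE
  DOUBLE-COSET BASIS OF THE HECKE ALGEBRA; `heckeAlgebraBasis_apply_single_one`;
* `finiteDoubleCosetEquiv` / `heckeAlgebraBasis'` / `finrank_heckeAlgebra` — when every orbit is
  finite (`K` compact open, `T5HeckeDoubleCoset.finite_orbit_coset_of_isOpen_of_isCompact`) the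
  basis is indexed by `K∖G/K` itself and `dim_k H(G, K) = #(K∖G/K)` when that is finite.

In the record: «`H(G, K) = C_c(K∖G/K)` has the characteristic functions of the double cosets as a
basis» — closed in kernel form as `heckeAlgebraBasis'`.  What stays prose: the Haar measure and the
identification of the product with convolution.

README §8(d): uses an L-value-free non-vanishing device: NO.
-/

namespace Summit.Ventures.HodgeRepro2.T5HeckeDoubleCosetBasis

noncomputable section

open Summit.Ventures.HodgeRepro2.LevelPositivity
open Summit.Ventures.HodgeRepro2.T5HeckePermutationModule
open Summit.Ventures.HodgeRepro2.T5HeckeDoubleCoset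
open MonoidAlgebra Representation MulAction

variable {G : Type*} [Group G] {k : Type*} [Field k]

section Coefficients

variable (k) (K : Subgroup G)

/-- The coefficients of the orbit vector of a finite set `O` form the indicator function of `O`. -/
theorem coeff_orbitVector {O : Set (G ⧸ K)} (hO : O.Finite) (y : G ⧸ K) :
    (orbitVector k K O).coeff y = O.indicator 1 y := by
  classical
  unfold orbitVector
  rw [finsum_mem_eq_finite_toFinset_sum _ hO, coeff_sum, Finsupp.finsetSum_apply]
  simp only [coeff_single, Finsupp.single_apply]
  rw [Finset.sum_ite_eq']
  simp [Set.indicator_apply, Set.Finite.mem_toFinset]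

variable {k K}

/-- `f ∈ k[G ⧸ K]^K` iff its coefficient function is constant on the `K`-orbits. -/
theorem mem_invariants_ofMulAction_iff {f : MonoidAlgebra k (G ⧸ K)} :
    f ∈ invariants (ofMulAction k G (G ⧸ K)) K ↔
      ∀ κ ∈ K, ∀ x : G ⧸ K, f.coeff (κ • x) = f.coeff x := by
  rw [mem_invariants_iff]
  constructor
  · intro h κ hκ x
    have := congrArg (fun z : MonoidAlgebra k (G ⧸ K) => z.coeff (κ • x)) (h κ hκ)
    simpa [coeff_ofMulAction, inv_smul_smul] using this.symm
  · intro h κ hκ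
    apply MonoidAlgebra.ext
    ext y
    rw [coeff_ofMulAction]
    exact h κ⁻¹ (inv_mem hκ) y

/-- The coefficients of a `K`-fixed vector agree along a `K`-orbit. -/
theorem coeff_eq_of_mem_orbit {f : MonoidAlgebra k (G ⧸ K)}
    (hf : f ∈ invariants (ofMulAction k G (G ⧸ K)) K) {x y : G ⧸ K} (hy : y ∈ orbit K x) :
    f.coeff y = f.coeff x := by
  obtain ⟨κ, rfl⟩ := mem_orbit_iff.mp hy
  exact mem_invariants_ofMulAction_iff.mp hf κ κ.2 x

end Coefficients

section Basis

variable (K : Subgroup G)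

/-- The double cosets `KgK` with `KgK/K` finite: the `K`-orbits on `G ⧸ K` with finite orbit. -/
def FiniteDoubleCoset : Type _ := {ω : orbitRel.Quotient K (G ⧸ K) // ω.orbit.Finite}

variable (k)

/-- The indicator `1_{KgK/K} ∈ k[G ⧸ K]` of a finite double coset. -/
def doubleCosetVector (ω : FiniteDoubleCoset K) : MonoidAlgebra k (G ⧸ K) :=
  orbitVector k K ω.1.orbit

/-- The coefficients of `1_{KgK/K}`. -/
theorem coeff_doubleCosetVector (ω : FiniteDoubleCoset K) (y : G ⧸ K) :
    (doubleCosetVector k K ω).coeff y = ω.1.orbit.indicator 1 y :=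
  coeff_orbitVector k K ω.2 y

/-- `1_{KgK/K}` is `K`-fixed. -/
theorem doubleCosetVector_mem_invariants (ω : FiniteDoubleCoset K) :
    doubleCosetVector k K ω ∈ invariants (ofMulAction k G (G ⧸ K)) K := by
  classical
  rw [mem_invariants_ofMulAction_iff]
  intro κ hκ x
  rw [coeff_doubleCosetVector, coeff_doubleCosetVector]
  have hmem : κ • x ∈ ω.1.orbit ↔ x ∈ ω.1.orbit := by
    rw [orbitRel.Quotient.mem_orbit, orbitRel.Quotient.mem_orbit]
    have : (Quotient.mk'' (κ • x) : orbitRel.Quotient K (G ⧸ K)) = Quotient.mk'' x :=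
      Quotient.sound' (by rw [orbitRel_apply]; exact ⟨⟨κ, hκ⟩, rfl⟩)
    rw [this]
  simp only [Set.indicator_apply, hmem, Pi.one_apply]

/-- The indicators of the finite double cosets are linearly independent. -/
theorem linearIndependent_doubleCosetVector : LinearIndependent k (doubleCosetVector k K) := by
  classical
  rw [linearIndependent_iff']
  intro s g hsum ω hω
  have := congrArg (fun z : MonoidAlgebra k (G ⧸ K) => z.coeff (Quotient.out ω.1)) hsum
  simp only [coeff_sum, Finsupp.finsetSum_apply, coeff_smul, Finsupp.smul_apply,
    coeff_doubleCosetVector, smul_eq_mul, coeff_zero, Finsupp.zero_apply] at this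
  rw [Finset.sum_eq_single ω] at this
  · rwa [Set.indicator_of_mem (orbitRel.Quotient.mem_orbit.mpr (Quotient.out_eq' _)), Pi.one_apply,
      mul_one] at this
  · intro ω' _ hne
    rw [Set.indicator_of_notMem, mul_zero]
    intro hmem
    exact hne (Subtype.ext ((orbitRel.Quotient.mem_orbit.mp hmem).symm.trans (Quotient.out_eq' _)))
  · intro h
    exact absurd hω h

/-- A `K`-fixed vector of `k[G ⧸ K]` is a linear combination of indicators of finite double cosets:
its support is a finite union of `K`-orbits, each of which is therefore finite. -/
theorem mem_span_doubleCosetVector {f : MonoidAlgebra k (G ⧸ K)}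
    (hf : f ∈ invariants (ofMulAction k G (G ⧸ K)) K) :
    f ∈ Submodule.span k (Set.range (doubleCosetVector k K)) := by
  classical
  set S := f.coeff.support with hS
  have horb : ∀ x ∈ S, (orbit K x).Finite ∧ orbit K x ⊆ (S : Set (G ⧸ K)) := by
    intro x hx
    have hsub : orbit K x ⊆ (S : Set (G ⧸ K)) := by
      intro y hy
      rw [Finset.mem_coe, hS, Finsupp.mem_support_iff, coeff_eq_of_mem_orbit hf hy]
      exact Finsupp.mem_support_iff.mp hx
    exact ⟨S.finite_toSet.subset hsub, hsub⟩
  let T : Finset (orbitRel.Quotient K (G ⧸ K)) := S.image (fun x => Quotient.mk'' x)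
  have hT : ∀ ω ∈ T, ω.orbit.Finite := by
    intro ω hω
    obtain ⟨x, hx, rfl⟩ := Finset.mem_image.mp hω
    rw [orbitRel.Quotient.orbit_mk]
    exact (horb x hx).1
  have key : f = ∑ ω ∈ T.attach,
      f.coeff (Quotient.out ω.1) • doubleCosetVector k K ⟨ω.1, hT ω.1 ω.2⟩ := by
    apply MonoidAlgebra.ext
    ext y
    rw [coeff_sum, Finsupp.finsetSum_apply]
    simp only [coeff_smul, Finsupp.smul_apply, coeff_doubleCosetVector, smul_eq_mul]
    by_cases hy : y ∈ S
    · rw [Finset.sum_eq_single ⟨Quotient.mk'' y, Finset.mem_image_of_mem _ hy⟩]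
      · rw [Set.indicator_of_mem (orbitRel.Quotient.mem_orbit.mpr rfl), Pi.one_apply, mul_one]
        refine (coeff_eq_of_mem_orbit hf ?_).symm
        rw [← orbitRel.Quotient.orbit_mk (G := K) y, orbitRel.Quotient.mem_orbit, Quotient.out_eq']
      · intro ω _ hne
        rw [Set.indicator_of_notMem, mul_zero]
        intro hmem
        exact hne (Subtype.ext (orbitRel.Quotient.mem_orbit.mp hmem).symm)
      · intro h
        exact absurd (Finset.mem_attach _ _) h
    · rw [Finsupp.notMem_support_iff.mp hy]
      symm
      apply Finset.sum_eq_zero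
      intro ω _
      rw [Set.indicator_of_notMem, mul_zero]
      intro hmem
      obtain ⟨x, hx, hωx⟩ := Finset.mem_image.mp ω.2
      rw [← hωx, orbitRel.Quotient.orbit_mk] at hmem
      exact hy ((horb x hx).2 hmem)
  rw [key]
  exact Submodule.sum_mem _ fun ω _ => Submodule.smul_mem _ _ (Submodule.subset_span ⟨_, rfl⟩)

/-- The indicators of the finite double cosets span exactly `k[G ⧸ K]^K`. -/
theorem span_doubleCosetVector_eq :
    Submodule.span k (Set.range (doubleCosetVector k K)) = invariants (ofMulAction k G (G ⧸ K)) K := by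
  apply le_antisymm
  · rw [Submodule.span_le]
    rintro _ ⟨ω, rfl⟩
    exact doubleCosetVector_mem_invariants k K ω
  · intro f hf
    exact mem_span_doubleCosetVector k K hf

/-- THE DOUBLE-COSET BASIS of `k[G ⧸ K]^K`. -/
def doubleCosetBasis : Module.Basis (FiniteDoubleCoset K) k (invariants (ofMulAction k G (G ⧸ K)) K) :=
  (Module.Basis.span (linearIndependent_doubleCosetVector k K)).map
    (LinearEquiv.ofEq _ _ (span_doubleCosetVector_eq k K))

/-- The basis vectors of `doubleCosetBasis` are the indicators `1_{KgK/K}`. -/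
@[simp] theorem doubleCosetBasis_apply (ω : FiniteDoubleCoset K) :
    (doubleCosetBasis k K ω : MonoidAlgebra k (G ⧸ K)) = doubleCosetVector k K ω := by
  simp [doubleCosetBasis]

/-- THE DOUBLE-COSET BASIS OF THE HECKE ALGEBRA `H(G, K) = End_G(k[G ⧸ K])`, through Frobenius
reciprocity `H(G, K) ≅ k[G ⧸ K]^K`. -/
def heckeAlgebraBasis : Module.Basis (FiniteDoubleCoset K) k (heckeAlgebra k K) :=
  (doubleCosetBasis k K).map (heckeAlgebraEquivInvariants (k := k) (K := K)).symm

/-- The basis element of `KgK` sends `δ_K` to the indicator `1_{KgK/K}`. -/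
theorem heckeAlgebraBasis_apply_single_one (ω : FiniteDoubleCoset K) :
    (heckeAlgebraBasis k K ω).1 (single ((1 : G) : G ⧸ K) 1) = doubleCosetVector k K ω := by
  rw [← heckeAlgebraEquivInvariants_apply, heckeAlgebraBasis, Module.Basis.map_apply,
    LinearEquiv.apply_symm_apply, doubleCosetBasis_apply]

/-- The basis element of `KgK` is the double-coset element `T_g` of `T5HeckeDoubleCoset`. -/
theorem heckeAlgebraBasis_eq_doubleCosetOp (ω : FiniteDoubleCoset K) (g : G)
    [Finite (orbit K (g : G ⧸ K))] (hg : (Quotient.mk'' (g : G ⧸ K) : orbitRel.Quotient K (G ⧸ K)) = ω.1) :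
    heckeAlgebraBasis k K ω = doubleCosetOp k K g := by
  apply (heckeAlgebraEquivInvariants (k := k) (K := K)).injective
  ext
  rw [heckeAlgebraEquivInvariants_apply, heckeAlgebraEquivInvariants_apply,
    heckeAlgebraBasis_apply_single_one, doubleCosetOp_apply_single_one, doubleCosetVector,
    ← hg, orbitRel.Quotient.orbit_mk]

/-- When every double coset is a finite union of left cosets (e.g. `K` compact open), the finite
double cosets are all of `K∖G/K`. -/
def finiteDoubleCosetEquiv (h : ∀ ω : orbitRel.Quotient K (G ⧸ K), ω.orbit.Finite) :
    FiniteDoubleCoset K ≃ orbitRel.Quotient K (G ⧸ K) :=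
  Equiv.subtypeUnivEquiv h

/-- THE DOUBLE-COSET BASIS OF `H(G, K)` INDEXED BY `K∖G/K`, when every double coset is a finite
union of left cosets. -/
def heckeAlgebraBasis' (h : ∀ ω : orbitRel.Quotient K (G ⧸ K), ω.orbit.Finite) :
    Module.Basis (orbitRel.Quotient K (G ⧸ K)) k (heckeAlgebra k K) :=
  (heckeAlgebraBasis k K).reindex (finiteDoubleCosetEquiv K h)

/-- `dim_k H(G, K) = #(K∖G/K)` when every double coset is a finite union of left cosets and there
are finitely many of them. -/
theorem finrank_heckeAlgebra (h : ∀ ω : orbitRel.Quotient K (G ⧸ K), ω.orbit.Finite)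
    [Fintype (orbitRel.Quotient K (G ⧸ K))] :
    Module.finrank k (heckeAlgebra k K) = Fintype.card (orbitRel.Quotient K (G ⧸ K)) :=
  Module.finrank_eq_card_basis (heckeAlgebraBasis' k K h)

/-- For `K` compact open in a topological group every double coset is a finite union of left
cosets (T5-53), so `H(G, K)` has the basis indexed by `K∖G/K`. -/
theorem forall_orbit_finite_of_isOpen_of_isCompact [TopologicalSpace G] [IsTopologicalGroup G]
    (hKo : IsOpen (K : Set G)) (hKc : IsCompact (K : Set G)) :
    ∀ ω : orbitRel.Quotient K (G ⧸ K), ω.orbit.Finite := by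
  intro ω
  induction ω using Quotient.inductionOn' with
  | h x =>
    induction x using QuotientGroup.induction_on with
    | H g =>
      rw [orbitRel.Quotient.orbit_mk]
      haveI := finite_orbit_coset_of_isOpen_of_isCompact K g hKo hKc
      exact Set.toFinite _

end Basis

end

end Summit.Ventures.HodgeRepro2.T5HeckeDoubleCosetBasis
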